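import Summits.QuantumFields.QCD.Theorems.SpectralDefectExtinctionExtinctionBuildsQCDStubSchemeVolumeTransfer

/-!
# Stub `stub_schemeVolumeTransferRel` of line `dilution-buys-local-rarity`
(crux `Summit.QuantumFields.QCD.Theses.SpectralDefectExtinction.ExtinctionBuildsQCD`, item stmt-QuantumFields-8968)

**Honest = clean + o(1) at the scheme's own side, in the RELATIVE currency.** Along a regularisation `reg`
with the EXTINCT clause at coercivity fraction `c > 0` and positive renormalised masses, for every insertion
string: if the defective part of the honest Berezin numerator (honest numerator minus its restriction to the
clean event `{defect count = 0}`) is `o(∫ |det D| dμ_W)` — `≤ ε ∫ |det D| dμ_W` eventually, for every `ε > 0` —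
and the clean sub-ensemble Schwinger function tends to `w`, then the honest lattice Schwinger function
`qcdLatticeSchwinger (reg.scheme m z shift) k n σ f` tends to `w`.

This is the lead's cycle-2 reshape of the landed per-defect version `stub_schemeVolumeTransfer`
(`SpectralDefectExtinctionExtinctionBuildsQCDStubSchemeVolumeTransfer.lean`, whose hypothesis is
`≤ C ∫ N_k |det D| dμ_W`); it is proved from that file's public lemmas: `det D > 0` on the clean event
(`det_diracMatrix_eq_norm_of_clean`), the clean/defective mass bounds (`clean_mass_bounds`), EXTINCT at
`S = L_k` (`eventually_defectMass_le`) and the quotient perturbation `norm_div_sub_div_le` with `C = 1`,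
`B = ε ∫ |det D| dμ_W` (the junk case `∫ |det D| dμ_W = 0` is exact equality of the two quotients).
-/

noncomputable section

open scoped BigOperators Topology SchwartzMap
open MeasureTheory Filter
open Literature.MathematicalPhysics.AQFT Literature.Probability.LatticeModels
  Literature.MathematicalPhysics.QuantumLattice Literature.MathematicalPhysics.QuantumFieldTheory
open Summit.QuantumFields.QCD.Theses.SpectralDefectExtinction
-- buildfix 2026-08-19: `extinctionBuildsQCD_iff` (unused here; an `Iff.rfl` against the retired body of the
-- route decl, removed from `Negative/WithoutTightCollapse` by its maintenance re-land) dropped from the `open` list.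
open Summit.QuantumFields.QCD.Theorems.ExtinctionBuildsQCD.Negative (Extinct Tight SDHyp
  measurable_signDefectCount measurable_coercivityDefectCount countP_roots_charpoly_le_card)

namespace Summit.QuantumFields.QCD.Cruxes.ExtinctionBuildsQCD.DilutionBuysLocalRarity

/-- **The per-step estimate in the relative currency.** On one torus (finite measure `μ`, masses `mq`,
arbitrary numerator functional `F`, bounded measurable count `N` on whose zero set the Wilson determinant
equals its modulus): if both the defect mass `∫ N |det D| dμ` and the defective numerator are
`≤ ε ∫ |det D| dμ` (`0 < ε ≤ 1/4`) and the clean quotient has modulus `≤ K`, then the honest quotient is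
within `2 (1 + K) ε` of the clean one. -/
theorem norm_ratio_sub_cleanRatio_le_rel {Nf L : ℕ} [NeZero L] (μ : Measure (GaugeConfig 4 L SU3))
    [IsFiniteMeasure μ] (mq : Fin Nf → ℝ) (F : GaugeConfig 4 L SU3 → ℂ) {Nn : GaugeConfig 4 L SU3 → ℕ}
    (hNm : Measurable Nn) {M : ℕ} (hNb : ∀ U, Nn U ≤ M)
    (hpos : ∀ U, Nn U = 0 → (diracMatrix U mq).det = ↑‖(diracMatrix U mq).det‖)
    {ε K : ℝ} (hε : 0 < ε) (hε4 : ε ≤ 1 / 4) (hK0 : 0 ≤ K)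
    (hrare : ∫ U, (Nn U : ℝ) * ‖(diracMatrix U mq).det‖ ∂μ ≤ ε * ∫ U, ‖(diracMatrix U mq).det‖ ∂μ)
    (hnum : ‖(∫ U, F U ∂μ) - ∫ U, (if Nn U = 0 then (1 : ℂ) else 0) * F U ∂μ‖ ≤
      ε * ∫ U, ‖(diracMatrix U mq).det‖ ∂μ)
    (hK : ‖(∫ U, (if Nn U = 0 then (1 : ℂ) else 0) * F U ∂μ) /
        ∫ U, (if Nn U = 0 then (1 : ℂ) else 0) * fermiIntegral (fermiBoltzmann U mq) ∂μ‖ ≤ K) :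
    ‖(∫ U, F U ∂μ) / (∫ U, fermiIntegral (fermiBoltzmann U mq) ∂μ) -
        (∫ U, (if Nn U = 0 then (1 : ℂ) else 0) * F U ∂μ) /
          ∫ U, (if Nn U = 0 then (1 : ℂ) else 0) * fermiIntegral (fermiBoltzmann U mq) ∂μ‖ ≤
      2 * (1 + K) * ε := by
  set es : ℂ := (-1 : ℂ) ^ (Fintype.card (FermiIdx Nf L) * (Fintype.card (FermiIdx Nf L) - 1) / 2 +
    Fintype.card (FermiIdx Nf L)) with hes
  have hes1 : ‖es‖ = 1 := by rw [hes, norm_pow, norm_neg, norm_one, one_pow]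
  have hG : (fun U : GaugeConfig 4 L SU3 => fermiIntegral (fermiBoltzmann U mq)) =
      fun U => es * (diracMatrix U mq).det :=
    funext fun U => fermiIntegral_fermiBoltzmann U mq
  have hGc : (fun U : GaugeConfig 4 L SU3 => (if Nn U = 0 then (1 : ℂ) else 0) * fermiIntegral (fermiBoltzmann U mq)) =
      fun U => es * ((if Nn U = 0 then (1 : ℂ) else 0) * (diracMatrix U mq).det) :=
    funext fun U => by rw [fermiIntegral_fermiBoltzmann, mul_left_comm]
  obtain ⟨h1, h2⟩ := clean_mass_bounds μ mq hNm hNb hpos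
  rw [hGc, integral_const_mul] at hK
  rw [hG, hGc, integral_const_mul, integral_const_mul]
  have hnum' : ‖(∫ U, F U ∂μ) - ∫ U, (if Nn U = 0 then (1 : ℂ) else 0) * F U ∂μ‖ ≤
      1 * (ε * ∫ U, ‖(diracMatrix U mq).det‖ ∂μ) := by rwa [one_mul]
  refine norm_div_sub_div_le (B := ε * ∫ U, ‖(diracMatrix U mq).det‖ ∂μ) ?_ ?_ hnum' le_rfl hε hε4
    zero_le_one hK0 hK
  · rw [← mul_sub, norm_mul, hes1, one_mul]
    exact h1.trans hrare
  · rw [norm_mul, hes1, one_mul]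
    linarith

/-- **Honest = clean + o(1) along a scheme with rare defects (abstract relative form).** Along any scheme,
for arbitrary numerator functionals `F k` and bounded measurable counts `N k` on whose zero sets the Wilson
determinant equals its modulus: if the defect mass and the defective numerators are both
`o(∫ |det D| dμ_W)` and the clean quotients tend to `w`, so do the honest ones. -/
theorem tendsto_ratio_of_rareDefects_rel {Nf : ℕ} (sch : QCDScheme Nf)
    (F : ∀ k, GaugeConfig 4 (sch.side k) SU3 → ℂ) (Nn : ∀ k, GaugeConfig 4 (sch.side k) SU3 → ℕ) (w : ℂ)
    (hNm : ∀ k, Measurable (Nn k)) (hNb : ∀ k, ∃ M : ℕ, ∀ U, Nn k U ≤ M)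
    (hpos : ∀ k U, Nn k U = 0 →
      (diracMatrix U fun fl => sch.mq fl k).det = ↑‖(diracMatrix U fun fl => sch.mq fl k).det‖)
    (hrare : ∀ ε : ℝ, 0 < ε → ∀ᶠ k in atTop,
      ∫ U, (Nn k U : ℝ) * ‖(diracMatrix U fun fl => sch.mq fl k).det‖ ∂(qcdGaugeMeasure sch k) ≤
        ε * ∫ U, ‖(diracMatrix U fun fl => sch.mq fl k).det‖ ∂(qcdGaugeMeasure sch k))
    (hrel : ∀ ε : ℝ, 0 < ε → ∀ᶠ k in atTop,
      ‖(∫ U, F k U ∂(qcdGaugeMeasure sch k)) -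
          ∫ U, (if Nn k U = 0 then (1 : ℂ) else 0) * F k U ∂(qcdGaugeMeasure sch k)‖ ≤
        ε * ∫ U, ‖(diracMatrix U fun fl => sch.mq fl k).det‖ ∂(qcdGaugeMeasure sch k))
    (hcl : Tendsto (fun k => (∫ U, (if Nn k U = 0 then (1 : ℂ) else 0) * F k U ∂(qcdGaugeMeasure sch k)) /
      ∫ U, (if Nn k U = 0 then (1 : ℂ) else 0) * fermiIntegral (fermiBoltzmann U fun fl => sch.mq fl k)
        ∂(qcdGaugeMeasure sch k)) atTop (𝓝 w)) :
    Tendsto (fun k => (∫ U, F k U ∂(qcdGaugeMeasure sch k)) /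
      ∫ U, fermiIntegral (fermiBoltzmann U fun fl => sch.mq fl k) ∂(qcdGaugeMeasure sch k)) atTop (𝓝 w) := by
  set clean : ℕ → ℂ := fun k =>
    (∫ U, (if Nn k U = 0 then (1 : ℂ) else 0) * F k U ∂(qcdGaugeMeasure sch k)) /
      ∫ U, (if Nn k U = 0 then (1 : ℂ) else 0) * fermiIntegral (fermiBoltzmann U fun fl => sch.mq fl k)
        ∂(qcdGaugeMeasure sch k) with hclean_def
  set honest : ℕ → ℂ := fun k => (∫ U, F k U ∂(qcdGaugeMeasure sch k)) /
      ∫ U, fermiIntegral (fermiBoltzmann U fun fl => sch.mq fl k) ∂(qcdGaugeMeasure sch k) with hhonest_def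
  -- the clean quotients are eventually bounded by `‖w‖ + 1`
  have hKev : ∀ᶠ k in atTop, ‖clean k‖ ≤ ‖w‖ + 1 := by
    filter_upwards [Metric.tendsto_nhds.1 hcl 1 one_pos] with k hk
    rw [dist_eq_norm] at hk
    linarith [norm_sub_norm_le (clean k) w]
  -- the key estimate
  have key : ∀ δ : ℝ, 0 < δ → ∀ᶠ k in atTop, ‖honest k - clean k‖ ≤ δ / 2 := by
    intro δ hδ
    have hK0 : 0 ≤ ‖w‖ + 1 := by positivity
    have hA : 0 < 1 + (‖w‖ + 1) := by positivity
    set ε : ℝ := min (1 / 4) (δ / (4 * (1 + (‖w‖ + 1)))) with hεdef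
    have hε : 0 < ε := lt_min (by norm_num) (by positivity)
    have hεδ : 2 * (1 + (‖w‖ + 1)) * ε ≤ δ / 2 :=
      calc 2 * (1 + (‖w‖ + 1)) * ε
          ≤ 2 * (1 + (‖w‖ + 1)) * (δ / (4 * (1 + (‖w‖ + 1)))) :=
            mul_le_mul_of_nonneg_left (min_le_right _ _) (by positivity)
        _ = δ / 2 := by field_simp; ring
    filter_upwards [hrel ε hε, hrare ε hε, hKev] with k hNk hRk hKk
    obtain ⟨M, hM⟩ := hNb k
    haveI : IsProbabilityMeasure (qcdGaugeMeasure sch k) := isProbabilityMeasure_wilsonMeasure_fundamental _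
    exact (norm_ratio_sub_cleanRatio_le_rel (qcdGaugeMeasure sch k) (fun fl => sch.mq fl k) (F k) (hNm k) hM
      (hpos k) hε (min_le_left _ _) hK0 hRk hNk hKk).trans hεδ
  -- conclusion: `honest = (honest - clean) + clean → 0 + w`
  have hdiff : Tendsto (fun k => honest k - clean k) atTop (𝓝 0) := Metric.tendsto_nhds.2 fun δ hδ =>
    (key δ hδ).mono fun k hk => by rw [dist_zero_right]; linarith
  simpa only [zero_add, sub_add_cancel] using hdiff.add hcl

/-- `stub_schemeVolumeTransferRel` — **the exchange identity made exact: honest = clean + o(1) at the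
scheme's own side, NO extinction rate, relative currency.** Along `reg` with EXTINCT, positive coercivity
fraction `c` and positive renormalised masses `m`, for every insertion string: if the defective part of the
honest numerator is `≤ ε ∫ |det D| dμ_W` eventually for every `ε > 0` (conditional defect regularity in the
relative form) and the clean sub-ensemble Schwinger function tends to `w`, then
`qcdLatticeSchwinger (reg.scheme m z shift) k n σ f → w` (`det D > 0` on the clean event,
`det_diracMatrix_eq_norm_of_clean`; EXTINCT at `S = L_k`, `eventually_defectMass_le`; quotient algebra,
`tendsto_ratio_of_rareDefects_rel`). -/
theorem stub_schemeVolumeTransferRel :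
    ∀ (Nf : ℕ) (reg : QCDRegularisation Nf) (c : ℝ) (m : Fin Nf → ℝ) (z shift : QCDField Nf → ℕ → ℝ)
      (n : ℕ) (σ : Fin n → QCDField Nf) (f : Fin n → 𝓢(EuclideanSpace ℝ (Fin 4), ℝ)) (w : ℂ),
      0 < c → (∀ fl, 0 < m fl) → Extinct Nf reg c m →
        (∀ ε : ℝ, 0 < ε → ∀ᶠ k : ℕ in atTop, ‖(∫ U, fermiIntegral ((List.ofFn fun i => smearedInsertion (reg.scheme m z shift) k U (σ i) (f i)).prod * fermiBoltzmann U fun fl => (reg.scheme m z shift).mq fl k) ∂(qcdGaugeMeasure (reg.scheme m z shift) k)) - ∫ U, (if (∑ g : Fin Nf, (Multiset.countP (fun z : ℂ => z.im = 0 ∧ z.re < -(reg.mcrit k + reg.a k * m g / reg.Zm k)) (wilsonDirac (fundamentalRep (Fin 3)) U 0 1).charpoly.roots + Multiset.countP (fun z : ℂ => |z.re| < c * (reg.a k * m g / reg.Zm k)) (spinorLift gammaFive * wilsonDirac (fundamentalRep (Fin 3)) U (reg.mcrit k + reg.a k * m g / reg.Zm k) 1).charpoly.roots)) = 0 then (1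 : ℂ) else 0) * fermiIntegral ((List.ofFn fun i => smearedInsertion (reg.scheme m z shift) k U (σ i) (f i)).prod * fermiBoltzmann U fun fl => (reg.scheme m z shift).mq fl k) ∂(qcdGaugeMeasure (reg.scheme m z shift) k)‖ ≤ ε * ∫ U, ‖(diracMatrix U fun fl => (reg.scheme m z shift).mq fl k).det‖ ∂(qcdGaugeMeasure (reg.scheme m z shift) k)) →
        Tendsto (fun k : ℕ => (∫ U, (if (∑ g : Fin Nf, (Multiset.countP (fun z : ℂ => z.im = 0 ∧ z.re < -(reg.mcrit k + reg.a k * m g / reg.Zm k)) (wilsonDirac (fundamentalRep (Fin 3)) U 0 1).charpoly.roots + Multiset.countP (fun z : ℂ => |z.re| < c * (reg.a k * m g / reg.Zm k)) (spinorLift gammaFive * wilsonDirac (fundamentalRep (Fin 3)) U (reg.mcrit k + reg.a k * m g / reg.Zm k) 1).charpoly.roots)) = 0 then (1 : ℂ) else 0) * fermiIntegral ((List.ofFn fun i => smearedInsertion (reg.scheme m z shift) k U (σ i) (f i)).prod * fermiBoltzmann U fun fl => (reg.scheme m z shift).mq fl k) ∂(qcdGaugeMeasure (reg.scheme m z shift)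 k)) / ∫ U, (if (∑ g : Fin Nf, (Multiset.countP (fun z : ℂ => z.im = 0 ∧ z.re < -(reg.mcrit k + reg.a k * m g / reg.Zm k)) (wilsonDirac (fundamentalRep (Fin 3)) U 0 1).charpoly.roots + Multiset.countP (fun z : ℂ => |z.re| < c * (reg.a k * m g / reg.Zm k)) (spinorLift gammaFive * wilsonDirac (fundamentalRep (Fin 3)) U (reg.mcrit k + reg.a k * m g / reg.Zm k) 1).charpoly.roots)) = 0 then (1 : ℂ) else 0) * fermiIntegral (fermiBoltzmann U fun fl => (reg.scheme m z shift).mq fl k) ∂(qcdGaugeMeasure (reg.scheme m z shift) k)) atTop (𝓝 w) →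
          Tendsto (fun k : ℕ => qcdLatticeSchwinger (reg.scheme m z shift) k n σ f) atTop (𝓝 w) := by
  intro Nf reg c m z shift n σ f w hc hm hE hrel hcl
  refine tendsto_ratio_of_rareDefects_rel (reg.scheme m z shift)
    (fun k U => fermiIntegral ((List.ofFn fun i => smearedInsertion (reg.scheme m z shift) k U (σ i) (f i)).prod *
      fermiBoltzmann U fun fl => (reg.scheme m z shift).mq fl k))
    (fun k U => (∑ g : Fin Nf, (Multiset.countP (fun z : ℂ => z.im = 0 ∧ z.re < -(reg.mcrit k + reg.a k * m g / reg.Zm k)) (wilsonDirac (fundamentalRep (Fin 3)) U 0 1).charpoly.roots + Multiset.countP (fun z : ℂ => |z.re| < c * (reg.a k * m g / reg.Zm k)) (spinorLift gammaFive * wilsonDirac (fundamentalRep (Fin 3)) U (reg.mcrit k + reg.a k * m g / reg.Zm k) 1).charpoly.roots)))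
    w ?_ ?_ ?_ ?_ ?_ ?_
  · exact fun k => Finset.measurable_sum _ fun g _ =>
      (measurable_signDefectCount _).add (measurable_coercivityDefectCount _ _)
  · exact fun k => ⟨∑ _g : Fin Nf, (Fintype.card (QuarkIdx ((reg.scheme m z shift).side k)) +
        Fintype.card (QuarkIdx ((reg.scheme m z shift).side k))),
      fun U => Finset.sum_le_sum fun g _ =>
        add_le_add (countP_roots_charpoly_le_card _ _) (countP_roots_charpoly_le_card _ _)⟩
  · exact fun k U hU => det_diracMatrix_eq_norm_of_clean reg hc hm k U hU
  · exact fun ε hε => eventually_defectMass_le reg c m z shift hE hε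
  · exact hrel
  · exact hcl

end Summit.QuantumFields.QCD.Cruxes.ExtinctionBuildsQCD.DilutionBuysLocalRarity

end
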